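import Mathlib
import Summits.NavierStokesRegularity.NavierStokesRegularity.Theorems.EulerZoomLiouvillePowerGaugeEulerLiouvilleSelfSimilarVorticityTransport
import HarnessLib.Audit

/-!
# The `q`-enstrophy balance along similarity orbits of a self-similar Euler profile —
# the Kelvin–Cauchy threshold `α*_q = 1 − 3γ/q` (helper of the crux
# `EulerZoomLiouville.PowerGaugeEulerLiouville`, route №10, item stmt-NavierStokesRegularity-19832)

Helper file (theorems only; no definitions, no named facts; `--supports
stmt-NavierStokesRegularity-19832`). Text custody nsreg-p2 (cell ns-regularity-ideate, ROUND-38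
«the Kelvin–Cauchy threshold is critical»); typed identity behind the NO-GO reading of the general
(non-axisymmetric) self-similar stratum `stub_selfSimilarC2Needle`.

For a velocity-form self-similar Euler profile `(1−γ)U + γ((y−c)·∇)U + (U·∇)U + ∇P = 0`,
`div U = 0` (`IsSelfSimilarEulerProfile γ c U P`, Constantin–Ignatova–Vicol (3.3)), with transport
field `W = γ(y − c) + U` (`selfSimilarTransport`, `div W = 3γ`) and vorticity `Ω = curl U`, along
ANY orbit `Y' = σ W(Y)` (`σ = 1` forward similarity time, `σ = −1` backward):

* `hasDerivAt_norm_curl_sq_comp` — `d/dt ‖Ω(Y t)‖² = 2σ (⟪Ω, DU Ω⟫ − ‖Ω‖²)(Y t)`: the vorticity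
  magnitude along orbits is driven by the STRETCHING RATE `α_U(Ω̂) = ⟪Ω̂, DU Ω̂⟫` against the
  threshold `1` (CIV Prop. 3.3 is the stationary case at the maximum of `|Ω|`);
* `hasDerivAt_exp_mul_norm_curl_sq_comp` — the JACOBIAN-WEIGHTED form (the flow of `σW` has
  Jacobian `e^{3γσt}`): `d/dt [e^{3γσt} ‖Ω(Y t)‖²] = 2σ e^{3γσt} (⟪Ω, DU Ω⟫ − (1 − 3γ/2)‖Ω‖²)(Y t)`.
  This is the Lagrangian form of Chae–Shvydkoy's identity (vor1) at `p = 2`,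
  `div(W |Ω|²/2) = (α_U(Ω̂) − α*)|Ω|²`, `α* = 1 − 3γ/2`: transported ENSTROPHY grows or decays
  according as the stretching rate beats `α* = 1 − 3γ/2 ∈ (¼, 2/5]` for `γ ∈ [2/5, ½)`;
* `hasDerivAt_exp_mul_norm_curl_rpow_comp` — the `q`-family (`q ≠ 0`, off the zero set of `Ω`):
  `d/dt [e^{3γσt} |Ω(Y t)|^q] = σ q e^{3γσt} |Ω|^{q−2} (⟪Ω, DU Ω⟫ − (1 − 3γ/q)|Ω|²)(Y t)`, threshold
  `α*_q = 1 − 3γ/q` — Chae–Shvydkoy's `p < N/(1+α)` in the power gauge;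
* `exp_mul_norm_curl_sq_le_of_stretching_le` — the one-sided Grönwall consequence: if
  `σ(⟪Ω, DUΩ⟫ − α*‖Ω‖²) ≤ σδ‖Ω‖²` along the orbit on `[0, T]` then
  `e^{3γσT}‖Ω(Y T)‖² ≤ e^{2σδT}‖Ω(Y 0)‖²` (and the mirror `_ge_` form);
* `integral_stretching_defect_eq` — the integrated balance
  `∫₀ᵀ 2σ e^{3γσs}(⟪Ω, DUΩ⟫ − α*‖Ω‖²)(Y s) ds = e^{3γσT}‖Ω(Y T)‖² − ‖Ω(Y 0)‖²`; on a CLOSED orbit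
  (`Y T = Y 0`) the `e^{3γσs}|Ω|²`-weighted mean of `α_U(Ω̂) − α*` has the sign of `σ` unless
  `Ω(Y 0) = 0` (`integral_stretching_defect_pos_of_closed`).

WHY (ROUND-38): in the A-gauge class the local budgets are scale-invariant by construction, so the
vorticity is in no global `L^q` and every Chae-type GLOBAL identity is exactly balanced by the flux
(feeding) terms — there is no symmetry-free clock; the axisymmetric swirl-free kill (ROUND-37) wins
only because `r⊥` is a coordinate (`α_U(e_φ) = U_{r⊥}/r⊥`). This file is the typed threshold, not a
kill. NOT here: the Eulerian divergence form and its integral over balls (flux through spheres).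

References: D. Chae, R. Shvydkoy, ARMA 209 (2013) §4, identity (vor1) and Thm. 4.1
[ChaeShvydkoy2013]; D. Chae, CMP 273 (2007) Thm. 1.1 [Chae2007CMPEuler]; P. Constantin,
M. Ignatova, V. Vicol, arXiv:2602.17570 §3.3 Prop. 3.3, §3.4.1 (3.22)
[ConstantinIgnatovaVicol2026Putative].
-/

noncomputable section

-- the summit and its single problem share the name `NavierStokesRegularity` (D-0017 nested layout)
set_option linter.dupNamespace false

open Set Filter Topology Metric Function InnerProductSpace MeasureTheory
open scoped RealInnerProductSpace NNReal

namespace Summit.NavierStokesRegularity.NavierStokesRegularity.Theorems.PowerGaugeEulerLiouville.EnstrophyBalance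

open Literature.Analysis Literature.Analysis.FluidPDE Literature.Analysis.ODE
open Summit.NavierStokesRegularity.NavierStokesRegularity.Theorems.PowerGaugeEulerLiouville.NodalFiniteness

variable {γ : ℝ} {c : (EuclideanSpace ℝ (Fin 3))}
  {U : (EuclideanSpace ℝ (Fin 3)) → (EuclideanSpace ℝ (Fin 3))} {P : (EuclideanSpace ℝ (Fin 3)) → ℝ}
  {σ : ℝ} {Y : ℝ → (EuclideanSpace ℝ (Fin 3))}

/-! ### The pointwise (Lagrangian) balance -/

/-- **`d/dt ‖Ω(Y t)‖² = 2σ(⟪Ω, DU Ω⟫ − ‖Ω‖²)(Y t)` along `Y' = σ W(Y)`** (`W = γ(y−c) + U`,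
`Ω = curl U`): from `dΩ(Y)/dt = σ(DW Ω − (1+γ)Ω)` (`hasDerivAt_curl_comp`) and `DW = γI + DU`.
[cite: ConstantinIgnatovaVicol2026Putative, §3.4.1 eq. (3.22)] -/
theorem hasDerivAt_norm_curl_sq_comp (h : IsSelfSimilarEulerProfile γ c U P) {t : ℝ}
    (hY : HasDerivAt Y (σ • selfSimilarTransport γ c U (Y t)) t) :
    HasDerivAt (fun s => ‖curl U (Y s)‖ ^ 2)
      (2 * σ * (⟪curl U (Y t), fderiv ℝ U (Y t) (curl U (Y t))⟫ - ‖curl U (Y t)‖ ^ 2)) t := by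
  have h1 := (hasDerivAt_curl_comp h hY).norm_sq
  refine h1.congr_deriv ?_
  rw [fderiv_transport_eq h (Y t), _root_.add_apply, _root_.smul_apply,
    ContinuousLinearMap.id_apply, inner_smul_right, inner_sub_right, inner_add_right,
    inner_smul_right, inner_smul_right, real_inner_self_eq_norm_sq]
  ring

/-- **The Jacobian-weighted balance (Chae–Shvydkoy (vor1) at `p = 2`, Lagrangian form).** Along
`Y' = σ W(Y)`: `d/dt [e^{3γσt}‖Ω(Y t)‖²] = 2σ e^{3γσt}(⟪Ω, DU Ω⟫ − (1 − 3γ/2)‖Ω‖²)(Y t)` — the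
transported enstrophy density grows (forward) exactly when the stretching rate `⟪Ω̂, DU Ω̂⟫` exceeds
the threshold `α* = 1 − 3γ/2`. [cite: ChaeShvydkoy2013, §4 eq. (vor1), Thm. 4.1] -/
theorem hasDerivAt_exp_mul_norm_curl_sq_comp (h : IsSelfSimilarEulerProfile γ c U P) {t : ℝ}
    (hY : HasDerivAt Y (σ • selfSimilarTransport γ c U (Y t)) t) :
    HasDerivAt (fun s => Real.exp (3 * γ * σ * s) * ‖curl U (Y s)‖ ^ 2)
      (2 * σ * Real.exp (3 * γ * σ * t) *
        (⟪curl U (Y t), fderiv ℝ U (Y t) (curl U (Y t))⟫ - (1 - 3 * γ / 2) * ‖curl U (Y t)‖ ^ 2)) t := by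
  have h1 : HasDerivAt (fun s : ℝ => Real.exp (3 * γ * σ * s))
      (Real.exp (3 * γ * σ * t) * (3 * γ * σ * 1)) t :=
    ((hasDerivAt_id t).const_mul (3 * γ * σ)).exp
  have h2 := hasDerivAt_norm_curl_sq_comp h hY
  refine (h1.mul h2).congr_deriv ?_
  ring

/-- **The `q`-family (Chae–Shvydkoy's threshold `p < N/(1+α)` in the power gauge).** Along
`Y' = σ W(Y)`, at a time where `Ω(Y t) ≠ 0`, for every real `q ≠ 0`:
`d/dt [e^{3γσt}(‖Ω(Y t)‖²)^{q/2}] = σ q e^{3γσt}(‖Ω‖²)^{q/2 − 1}(⟪Ω, DU Ω⟫ − (1 − 3γ/q)‖Ω‖²)(Y t)`,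
threshold `α*_q = 1 − 3γ/q`. [cite: ChaeShvydkoy2013, §4 eq. (vor1), Thm. 4.1] -/
theorem hasDerivAt_exp_mul_norm_curl_rpow_comp (h : IsSelfSimilarEulerProfile γ c U P) {t q : ℝ}
    (hY : HasDerivAt Y (σ • selfSimilarTransport γ c U (Y t)) t) (hΩ : curl U (Y t) ≠ 0)
    (hq : q ≠ 0) :
    HasDerivAt (fun s => Real.exp (3 * γ * σ * s) * (‖curl U (Y s)‖ ^ 2) ^ (q / 2))
      (σ * q * Real.exp (3 * γ * σ * t) * (‖curl U (Y t)‖ ^ 2) ^ (q / 2 - 1) *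
        (⟪curl U (Y t), fderiv ℝ U (Y t) (curl U (Y t))⟫ - (1 - 3 * γ / q) * ‖curl U (Y t)‖ ^ 2)) t := by
  have hpos : 0 < ‖curl U (Y t)‖ ^ 2 := by positivity
  have h1 : HasDerivAt (fun s : ℝ => Real.exp (3 * γ * σ * s))
      (Real.exp (3 * γ * σ * t) * (3 * γ * σ * 1)) t :=
    ((hasDerivAt_id t).const_mul (3 * γ * σ)).exp
  have h2 := (hasDerivAt_norm_curl_sq_comp h hY).rpow_const (p := q / 2) (Or.inl hpos.ne')
  refine (h1.mul h2).congr_deriv ?_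
  have hsplit : (‖curl U (Y t)‖ ^ 2) ^ (q / 2) = (‖curl U (Y t)‖ ^ 2) ^ (q / 2 - 1) * ‖curl U (Y t)‖ ^ 2 := by
    rw [← Real.rpow_add_one hpos.ne' (q / 2 - 1)]
    ring_nf
  simp only [mul_one]
  rw [hsplit]
  field_simp
  ring

/-! ### One-sided consequences (Grönwall along the orbit) -/

/-- **Sub-threshold stretching starves transported enstrophy.** If along `Y' = σW(Y)` on `[0, T]`
`σ(⟪Ω, DUΩ⟫ − (1 − 3γ/2)‖Ω‖²)(Y s) ≤ σ δ ‖Ω(Y s)‖²`, then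
`e^{3γσT}‖Ω(Y T)‖² ≤ e^{2σδT}‖Ω(Y 0)‖²`. [cite: ChaeShvydkoy2013, §4 Thm. 4.1] -/
theorem exp_mul_norm_curl_sq_le_of_stretching_le (h : IsSelfSimilarEulerProfile γ c U P) {T δ : ℝ}
    (hT : 0 ≤ T) (hY : ∀ s ∈ Icc 0 T, HasDerivAt Y (σ • selfSimilarTransport γ c U (Y s)) s)
    (hstr : ∀ s ∈ Icc 0 T,
      σ * (⟪curl U (Y s), fderiv ℝ U (Y s) (curl U (Y s))⟫ - (1 - 3 * γ / 2) * ‖curl U (Y s)‖ ^ 2)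
        ≤ σ * δ * ‖curl U (Y s)‖ ^ 2) :
    Real.exp (3 * γ * σ * T) * ‖curl U (Y T)‖ ^ 2 ≤ Real.exp (2 * σ * δ * T) * ‖curl U (Y 0)‖ ^ 2 := by
  -- `g(s) = e^{−2σδs} e^{3γσs}‖Ω(Y s)‖²` is non-increasing on `[0, T]`
  set g : ℝ → ℝ := fun s => Real.exp (-(2 * σ * δ) * s) * (Real.exp (3 * γ * σ * s) * ‖curl U (Y s)‖ ^ 2)
    with hg
  set g' : ℝ → ℝ := fun s => Real.exp (-(2 * σ * δ) * s) * (2 * σ * Real.exp (3 * γ * σ * s) *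
      ((⟪curl U (Y s), fderiv ℝ U (Y s) (curl U (Y s))⟫ - (1 - 3 * γ / 2) * ‖curl U (Y s)‖ ^ 2)
        - δ * ‖curl U (Y s)‖ ^ 2)) with hg'
  have hderiv : ∀ s ∈ Icc 0 T, HasDerivAt g (g' s) s := by
    intro s hs
    have h1 : HasDerivAt (fun s : ℝ => Real.exp (-(2 * σ * δ) * s))
        (Real.exp (-(2 * σ * δ) * s) * (-(2 * σ * δ) * 1)) s :=
      ((hasDerivAt_id s).const_mul (-(2 * σ * δ))).exp
    have h2 := hasDerivAt_exp_mul_norm_curl_sq_comp h (hY s hs)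
    refine (h1.mul h2).congr_deriv ?_
    simp only [hg']
    ring
  have hcont : ContinuousOn g (Icc 0 T) := fun s hs => (hderiv s hs).continuousAt.continuousWithinAt
  have hanti : AntitoneOn g (Icc 0 T) := by
    refine antitoneOn_of_hasDerivWithinAt_nonpos (convex_Icc 0 T) hcont (f' := g') ?_ ?_
    · intro s hs
      rw [interior_Icc] at hs
      exact (hderiv s (Ioo_subset_Icc_self hs)).hasDerivWithinAt
    · intro s hs
      rw [interior_Icc] at hs
      have := hstr s (Ioo_subset_Icc_self hs)
      simp only [hg']
      have hexp1 : 0 < Real.exp (-(2 * σ * δ) * s) := Real.exp_pos _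
      have hexp2 : 0 < Real.exp (3 * γ * σ * s) := Real.exp_pos _
      have hcore : σ * ((⟪curl U (Y s), fderiv ℝ U (Y s) (curl U (Y s))⟫
          - (1 - 3 * γ / 2) * ‖curl U (Y s)‖ ^ 2) - δ * ‖curl U (Y s)‖ ^ 2) ≤ 0 := by nlinarith
      have : 2 * σ * Real.exp (3 * γ * σ * s) *
          ((⟪curl U (Y s), fderiv ℝ U (Y s) (curl U (Y s))⟫ - (1 - 3 * γ / 2) * ‖curl U (Y s)‖ ^ 2)
            - δ * ‖curl U (Y s)‖ ^ 2) ≤ 0 := by nlinarith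
      exact mul_nonpos_of_nonneg_of_nonpos hexp1.le this
  have hmono := hanti (left_mem_Icc.2 hT) (right_mem_Icc.2 hT) hT
  simp only [hg, mul_zero, Real.exp_zero, one_mul] at hmono
  -- unpack `e^{−2σδT} e^{3γσT}‖Ω(Y T)‖² ≤ ‖Ω(Y 0)‖²`
  have hexp : 0 < Real.exp (2 * σ * δ * T) := Real.exp_pos _
  have hkey : Real.exp (2 * σ * δ * T) * (Real.exp (-(2 * σ * δ) * T) *
      (Real.exp (3 * γ * σ * T) * ‖curl U (Y T)‖ ^ 2)) ≤ Real.exp (2 * σ * δ * T) * ‖curl U (Y 0)‖ ^ 2 :=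
    mul_le_mul_of_nonneg_left hmono hexp.le
  calc Real.exp (3 * γ * σ * T) * ‖curl U (Y T)‖ ^ 2
      = Real.exp (2 * σ * δ * T) * (Real.exp (-(2 * σ * δ) * T) *
          (Real.exp (3 * γ * σ * T) * ‖curl U (Y T)‖ ^ 2)) := by
        rw [← mul_assoc, ← Real.exp_add]
        simp
    _ ≤ Real.exp (2 * σ * δ * T) * ‖curl U (Y 0)‖ ^ 2 := hkey

/-- **Super-threshold stretching feeds transported enstrophy** (mirror form): if along `Y' = σW(Y)`
on `[0, T]` `σ δ ‖Ω(Y s)‖² ≤ σ(⟪Ω, DUΩ⟫ − (1 − 3γ/2)‖Ω‖²)(Y s)`, then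
`e^{2σδT}‖Ω(Y 0)‖² ≤ e^{3γσT}‖Ω(Y T)‖²`. [cite: ChaeShvydkoy2013, §4 Thm. 4.1] -/
theorem exp_mul_norm_curl_sq_ge_of_stretching_ge (h : IsSelfSimilarEulerProfile γ c U P) {T δ : ℝ}
    (hT : 0 ≤ T) (hY : ∀ s ∈ Icc 0 T, HasDerivAt Y (σ • selfSimilarTransport γ c U (Y s)) s)
    (hstr : ∀ s ∈ Icc 0 T,
      σ * δ * ‖curl U (Y s)‖ ^ 2 ≤
        σ * (⟪curl U (Y s), fderiv ℝ U (Y s) (curl U (Y s))⟫ - (1 - 3 * γ / 2) * ‖curl U (Y s)‖ ^ 2)) :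
    Real.exp (2 * σ * δ * T) * ‖curl U (Y 0)‖ ^ 2 ≤ Real.exp (3 * γ * σ * T) * ‖curl U (Y T)‖ ^ 2 := by
  set g : ℝ → ℝ := fun s => Real.exp (-(2 * σ * δ) * s) * (Real.exp (3 * γ * σ * s) * ‖curl U (Y s)‖ ^ 2)
    with hg
  set g' : ℝ → ℝ := fun s => Real.exp (-(2 * σ * δ) * s) * (2 * σ * Real.exp (3 * γ * σ * s) *
      ((⟪curl U (Y s), fderiv ℝ U (Y s) (curl U (Y s))⟫ - (1 - 3 * γ / 2) * ‖curl U (Y s)‖ ^ 2)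
        - δ * ‖curl U (Y s)‖ ^ 2)) with hg'
  have hderiv : ∀ s ∈ Icc 0 T, HasDerivAt g (g' s) s := by
    intro s hs
    have h1 : HasDerivAt (fun s : ℝ => Real.exp (-(2 * σ * δ) * s))
        (Real.exp (-(2 * σ * δ) * s) * (-(2 * σ * δ) * 1)) s :=
      ((hasDerivAt_id s).const_mul (-(2 * σ * δ))).exp
    have h2 := hasDerivAt_exp_mul_norm_curl_sq_comp h (hY s hs)
    refine (h1.mul h2).congr_deriv ?_
    simp only [hg']
    ring
  have hcont : ContinuousOn g (Icc 0 T) := fun s hs => (hderiv s hs).continuousAt.continuousWithinAt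
  have hmono : MonotoneOn g (Icc 0 T) := by
    refine monotoneOn_of_hasDerivWithinAt_nonneg (convex_Icc 0 T) hcont (f' := g') ?_ ?_
    · intro s hs
      rw [interior_Icc] at hs
      exact (hderiv s (Ioo_subset_Icc_self hs)).hasDerivWithinAt
    · intro s hs
      rw [interior_Icc] at hs
      have := hstr s (Ioo_subset_Icc_self hs)
      simp only [hg']
      have hexp1 : 0 < Real.exp (-(2 * σ * δ) * s) := Real.exp_pos _
      have hexp2 : 0 < Real.exp (3 * γ * σ * s) := Real.exp_pos _
      have hcore : 0 ≤ σ * ((⟪curl U (Y s), fderiv ℝ U (Y s) (curl U (Y s))⟫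
          - (1 - 3 * γ / 2) * ‖curl U (Y s)‖ ^ 2) - δ * ‖curl U (Y s)‖ ^ 2) := by nlinarith
      have : 0 ≤ 2 * σ * Real.exp (3 * γ * σ * s) *
          ((⟪curl U (Y s), fderiv ℝ U (Y s) (curl U (Y s))⟫ - (1 - 3 * γ / 2) * ‖curl U (Y s)‖ ^ 2)
            - δ * ‖curl U (Y s)‖ ^ 2) := by nlinarith
      exact mul_nonneg hexp1.le this
  have hle := hmono (left_mem_Icc.2 hT) (right_mem_Icc.2 hT) hT
  simp only [hg, mul_zero, Real.exp_zero, one_mul] at hle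
  have hexp : 0 < Real.exp (2 * σ * δ * T) := Real.exp_pos _
  have hkey : Real.exp (2 * σ * δ * T) * ‖curl U (Y 0)‖ ^ 2 ≤ Real.exp (2 * σ * δ * T) *
      (Real.exp (-(2 * σ * δ) * T) * (Real.exp (3 * γ * σ * T) * ‖curl U (Y T)‖ ^ 2)) :=
    mul_le_mul_of_nonneg_left hle hexp.le
  calc Real.exp (2 * σ * δ * T) * ‖curl U (Y 0)‖ ^ 2
      ≤ Real.exp (2 * σ * δ * T) * (Real.exp (-(2 * σ * δ) * T) *
          (Real.exp (3 * γ * σ * T) * ‖curl U (Y T)‖ ^ 2)) := hkey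
    _ = Real.exp (3 * γ * σ * T) * ‖curl U (Y T)‖ ^ 2 := by
        rw [← mul_assoc, ← Real.exp_add]
        simp

/-! ### The integrated balance and closed orbits -/

/-- The stretching defect `s ↦ 2σ e^{3γσs}(⟪Ω, DUΩ⟫ − (1 − 3γ/2)‖Ω‖²)(Y s)` is continuous along a
`C¹` orbit of a `C²` profile. [cite: ConstantinIgnatovaVicol2026Putative, §3.4 eq. (3.19)] -/
theorem continuous_stretching_defect (h : IsSelfSimilarEulerProfile γ c U P)
    (hY : ∀ s, HasDerivAt Y (σ • selfSimilarTransport γ c U (Y s)) s) :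
    Continuous fun s => 2 * σ * Real.exp (3 * γ * σ * s) *
      (⟪curl U (Y s), fderiv ℝ U (Y s) (curl U (Y s))⟫ - (1 - 3 * γ / 2) * ‖curl U (Y s)‖ ^ 2) := by
  have hYc : Continuous Y := continuous_iff_continuousAt.2 fun s => (hY s).continuousAt
  have hU2 : ContDiff ℝ 2 U := h.contDiff_velocity
  have hcurl : Continuous (curl U) :=
    (h.isSelfSimilarEulerVorticityProfile.differentiable_curl).continuous
  have hΩ : Continuous fun s => curl U (Y s) := hcurl.comp hYc
  have hD : Continuous fun s => fderiv ℝ U (Y s) :=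
    (hU2.continuous_fderiv (by norm_num)).comp hYc
  have hDΩ : Continuous fun s => fderiv ℝ U (Y s) (curl U (Y s)) :=
    hD.clm_apply hΩ
  have hinner : Continuous fun s => ⟪curl U (Y s), fderiv ℝ U (Y s) (curl U (Y s))⟫ :=
    hΩ.inner hDΩ
  fun_prop

/-- **The integrated balance.** Along a global `C¹` orbit `Y' = σW(Y)`, for every `T`:
`∫₀ᵀ 2σ e^{3γσs}(⟪Ω, DUΩ⟫ − (1 − 3γ/2)‖Ω‖²)(Y s) ds = e^{3γσT}‖Ω(Y T)‖² − ‖Ω(Y 0)‖²`.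
[cite: ChaeShvydkoy2013, §4 eq. (vor1)] -/
theorem integral_stretching_defect_eq (h : IsSelfSimilarEulerProfile γ c U P) {T : ℝ}
    (hY : ∀ s, HasDerivAt Y (σ • selfSimilarTransport γ c U (Y s)) s) :
    ∫ s in (0 : ℝ)..T, 2 * σ * Real.exp (3 * γ * σ * s) *
        (⟪curl U (Y s), fderiv ℝ U (Y s) (curl U (Y s))⟫ - (1 - 3 * γ / 2) * ‖curl U (Y s)‖ ^ 2)
      = Real.exp (3 * γ * σ * T) * ‖curl U (Y T)‖ ^ 2 - ‖curl U (Y 0)‖ ^ 2 := by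
  have hderiv : ∀ s ∈ uIcc 0 T, HasDerivAt (fun s => Real.exp (3 * γ * σ * s) * ‖curl U (Y s)‖ ^ 2)
      (2 * σ * Real.exp (3 * γ * σ * s) *
        (⟪curl U (Y s), fderiv ℝ U (Y s) (curl U (Y s))⟫ - (1 - 3 * γ / 2) * ‖curl U (Y s)‖ ^ 2)) s :=
    fun s _ => hasDerivAt_exp_mul_norm_curl_sq_comp h (hY s)
  have hint := (continuous_stretching_defect h hY).intervalIntegrable (μ := volume) 0 T
  rw [intervalIntegral.integral_eq_sub_of_hasDerivAt hderiv hint]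
  simp

/-- **Closed orbits are super-threshold on average.** On a closed orbit (`Y T = Y 0`, `T > 0`,
`σ > 0`) carrying vorticity (`Ω(Y 0) ≠ 0`) the `e^{3γσs}|Ω|²`-weighted integral of the stretching
defect `α_U(Ω̂) − α*` is strictly positive (`= (e^{3γσT} − 1)‖Ω(Y 0)‖²`), for `γ > 0`.
[cite: ChaeShvydkoy2013, §4 eq. (vor1)] -/
theorem integral_stretching_defect_pos_of_closed (h : IsSelfSimilarEulerProfile γ c U P) (hγ : 0 < γ)
    (hσ : 0 < σ) {T : ℝ} (hT : 0 < T)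
    (hY : ∀ s, HasDerivAt Y (σ • selfSimilarTransport γ c U (Y s)) s) (hclosed : Y T = Y 0)
    (hΩ : curl U (Y 0) ≠ 0) :
    0 < ∫ s in (0 : ℝ)..T, 2 * σ * Real.exp (3 * γ * σ * s) *
        (⟪curl U (Y s), fderiv ℝ U (Y s) (curl U (Y s))⟫ - (1 - 3 * γ / 2) * ‖curl U (Y s)‖ ^ 2) := by
  rw [integral_stretching_defect_eq h hY, hclosed]
  have hpos : 0 < ‖curl U (Y 0)‖ ^ 2 := by positivity
  have hexp : 1 < Real.exp (3 * γ * σ * T) := Real.one_lt_exp_iff.2 (by positivity)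
  nlinarith

end Summit.NavierStokesRegularity.NavierStokesRegularity.Theorems.PowerGaugeEulerLiouville.EnstrophyBalance
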